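import Mathlib
import Summits.HodgeConjecture.FermatCycles.HodgeFermatMuEven
import Summits.HodgeConjecture.FermatCycles.HodgeFermatNuOddSharp

/-!
# THEOREM F* at the prime levels by point evaluation — part 1: indicators, models, (Z3,Z3), (Z3,Z1), (Z1,Z1) (`HodgeFermat/Decoding.lean`)

Tree copy (part 1 of 3) of the module `HodgeFermat/Decoding.lean` of the sibling cell's standalone package
`run/shared/lean/pub/pub-hodgefermat/lean/HodgeFermat/` (688 lines, sha256 `9f6bff044f160188…`), source lines 26–255 (§1 indicators, §2 model functions, §§3–5 the field lemmas `core33`, `core31`, `coreZZ`).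
Filed by cell `pub-hfermat`, seat prover-1 gen-0, on the COORDINATOR KEEPER RULING of 2026-08-25 (gem sweep H1: take the
off-gate kernel theorem `thmFstar` — `HodgeFermat/DecodingFinal.lean:29` — through the gate); this file is one link of the
minimal import closure of `thmFstar`.  The source module's declarations are VERBATIM those of the cell record
`check/DecodingFinal_standalone.lean` (27 bodies, 454 223 B, sha256 dca6f17de93119a6…, hub `lean check` rc 0, 130.1 s; pub-hodgefermat `CERT.md` l.978, GATE HF-G32).
Deviations from the source module, exhaustively: the `import` lines (tree modules `Summits.HodgeConjecture.FermatCycles.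
HodgeFermat*` instead of `HodgeFermat.*`); this module docstring; one-line docstrings added (gate lint) to `ind_pos`, `ind_neg`, `ind_bd`, `ind_True`, `ind_False`, `mZ`, `dZ`, `mU`, `nU`, `mU_swap`, `mU_rot`, `nU_swap`, `nU_rot`, `mul_ne`, `core33`, `core31`, `coreZZ`; the file ends at source l.255 with `end Core` and an `end` line (parts 2, 3 = `HodgeFermatDecodingB/C.lean`).
Every other line — in particular every declaration's statement and proof — is byte-identical to the source.
HONEST FRAMING: explicit algebraic cycles for specific Hodge classes on Fermat/Delsarte varieties; residual open instances
listed; no claim on general Hodge.  (This file is arithmetic of CM types; it claims nothing about cycles.)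

The source module's docstring (Decoding.lean l.1–22), verbatim:

Copyright: pub-hodgefermat, generation 32 (HF-G32).  KR-free.
## Decoding — THEOREM F* of `tables/DPRIME-THEOREM.md` §9 at the PRIME LEVELS 3p, p ≥ 11, p ≠ 13, by POINT EVALUATION
  of the parity relations "μ_T − μ_T′ even" (`MuEven.mu_even`) and "ν_T − ν_T′ odd" (`NuOddSharp.nu_odd'`, `nu_sum_eq'`).
  Light module (hypothesis `H0`); `DecodingFinal` discharges `H0` with `HurwitzZero.hypH0`.

THEOREM F*(3p) `thmFstar`: for a prime `p ≥ 11`, `p ≠ 13`, two zero-sum triples mod `3p` with entries prime to `p` which are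
DISJOINT (no entry of one congruent mod `3p` to an entry of the other) do NOT have the same CM type.

PROOF (generation 32; replaces the ⟨3⟩-orbit calculus of DPRIME §8, NO exceptional primes; write-up DPRIME §9): by
HF-G31c/e (+ `NuOddSharp`: p ≥ 11, p ≠ 13) `E = μ_T − μ_T′` is EVEN, `D = ν_T − ν_T′` is ODD on `ℤ/p` and `Σ_T χ₃ = Σ_{T′} χ₃`; evaluating E and D at the
residues of the entries (and at `3·` them) is contradictory for every pair of 3-patterns (U / Z1 = `(3y, u, v)` / Z3),
using only `2, 3, 4, 5, 7, 8, 9, 13, 15 ≠ 0` in `ℤ/p`: (U, Z·) `Σχ₃ = ±3 ≠ 0`; (Z3, Z3) `core33`; (Z3, Z1) `core31`;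
(Z1, Z1) `coreZZ`; (U, U) `coreUU` (`u, 3u, 9u ∈ T` forces `13u = 0`: the genuine exception is p = 13, level 39).
The indicator `ind P ∈ {0, 1}` stays folded: each evaluated relation is a linear integer relation between a few
indicator atoms, settled by `omega` once the relevant (in)equalities of residues are decided by `linear_combination`.
§§1–6: an arbitrary field `F`; §7: dictionary `muFun`/`nuFun` ↦ model functions on `ZMod p`; §8: assembly (3-pattern
normalised by the type-preserving permutations `st_swap`, `st_rot`, re-proved from `LemmaN.rsum_cases`).
So THEOREM F* at prime levels follows from `H0` ALONE (no `KR6′`, no `ThmUPlus′`).  Cross-read `code/gen32/thmF_scan.py`.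
Record `check/Decoding_standalone.lean` (10 bodies); controls `code/gen32/lean-controls-g32/`.  No `sorry`; no `decide`;
axioms [propext, Classical.choice, Quot.sound].  NOT imported by the root `HodgeFermat.lean`.
-/

set_option autoImplicit false

namespace HodgeFermat.KRFree.Decoding

open HodgeFermat.KRFree.LemmaN HodgeFermat.KRFree.LemmaEMu
open HodgeFermat.KRFree.MuEven (muEntry muFun mu_even)
open HodgeFermat.KRFree.NuOdd (nuEntry nuFun)
open HodgeFermat.KRFree.NuOddSharp (nu_odd' nu_sum_eq')
open HodgeFermat.KRFree.ChiThree (chi3 chi3_ne_zero)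

/-! ## 1. Indicators -/

/-- the indicator `[P] ∈ {0, 1} ⊂ ℤ` of a decidable proposition (kept FOLDED: `omega` treats `ind P` as an atom) -/
def ind (P : Prop) [Decidable P] : ℤ := if P then 1 else 0

/-- `ind P = 1` when `P` holds -/
lemma ind_pos {P : Prop} [Decidable P] (h : P) : ind P = 1 := if_pos h
/-- `ind P = 0` when `P` fails -/
lemma ind_neg {P : Prop} [Decidable P] (h : ¬ P) : ind P = 0 := if_neg h
/-- `0 ≤ ind P ≤ 1` -/
lemma ind_bd (P : Prop) [Decidable P] : 0 ≤ ind P ∧ ind P ≤ 1 := by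
  unfold ind; split_ifs <;> simp
/-- `ind True = 1` -/
lemma ind_True {h : Decidable True} : @ind True h = 1 := if_pos trivial
/-- `ind False = 0` -/
lemma ind_False {h : Decidable False} : @ind False h = 0 := if_neg not_false

section Model

variable {F : Type*} [CommRing F] [DecidableEq F]

/-! ## 2. Model functions on `F` (= `ℤ/p`): `mZ` = μ of a Z1 triple `(3y, u, v)`, `dZ` = (ν_T − ν_T′)/η of two aligned
Z1 triples, `mU` = μ of a U triple, `nU` = ν/η of a U triple = μ/2 of a Z3 triple -/

/-- model `μ` of a Z1 triple `(3y, u, v)` at `x` -/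
def mZ (Y U V x : F) : ℤ := 2 * ind (Y = x) + (ind (U = x) - ind (U = 3 * x)) + (ind (V = x) - ind (V = 3 * x))

/-- model `(ν_T − ν_T′)/η` of two aligned Z1 triples at `x` -/
def dZ (U V U' V' x : F) : ℤ := ind (U = x) - ind (V = x) - (ind (U' = x) - ind (V' = x))

/-- model `μ` of a U triple at `x` -/
def mU (U V W x : F) : ℤ :=
  (ind (U = x) - ind (U = 3 * x)) + (ind (V = x) - ind (V = 3 * x)) + (ind (W = x) - ind (W = 3 * x))

/-- model `ν/η` of a U triple (= `μ/2` of a Z3 triple) at `x` -/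
def nU (U V W x : F) : ℤ := ind (U = x) + ind (V = x) + ind (W = x)

/-- `mU` is symmetric in its first two entries -/
lemma mU_swap (U V W x : F) : mU V U W x = mU U V W x := by unfold mU; ring
/-- `mU` is invariant under rotating the entries -/
lemma mU_rot (U V W x : F) : mU W U V x = mU U V W x := by unfold mU; ring
omit [CommRing F] in
/-- `nU` is symmetric in its first two entries -/
lemma nU_swap (U V W x : F) : nU V U W x = nU U V W x := by unfold nU; ring
omit [CommRing F] in
/-- `nU` is invariant under rotating the entries -/
lemma nU_rot (U V W x : F) : nU W U V x = nU U V W x := by unfold nU; ring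

end Model

section Core

variable {F : Type*} [Field F] [DecidableEq F]

omit [DecidableEq F] in
/-- in a field: `k ≠ 0`, `Y ≠ 0`, `kY = 0` is absurd -/
lemma mul_ne {k Y : F} (hk : k ≠ 0) (hY : Y ≠ 0) (h : k * Y = 0) : False := (mul_ne_zero hk hY) h

/-! ## 3. (Z3, Z3): `E = μ_T − μ_T′` even is impossible (evaluate at `x = I`) -/

/-- (Z3, Z3): "`E = μ_T − μ_T′` even" is impossible (evaluate at `x = I`) -/
theorem core33 (h2 : (2 : F) ≠ 0) {I J K I' J' K' : F} (hs : I + J + K = 0)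
    (hI : I ≠ 0) (hJ : J ≠ 0) (hK : K ≠ 0) (hd1 : I' ≠ I) (hd2 : J' ≠ I) (hd3 : K' ≠ I)
    (hE : ∀ x, 2 * nU I J K (-x) - 2 * nU I' J' K' (-x) = 2 * nU I J K x - 2 * nU I' J' K' x) : False := by
  have f1 : I ≠ -I := fun h => mul_ne h2 hI (by linear_combination h)
  have f2 : J ≠ -I := fun h => hK (by linear_combination hs - h)
  have f3 : K ≠ -I := fun h => hJ (by linear_combination hs - h)
  have e := hE I
  simp only [nU, ind_True, ind_neg f1, ind_neg f2, ind_neg f3, ind_neg hd1, ind_neg hd2, ind_neg hd3] at e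
  have := ind_bd (J = I); have := ind_bd (K = I)
  have := ind_bd (I' = -I); have := ind_bd (J' = -I); have := ind_bd (K' = -I)
  omega

/-! ## 4. (Z3, Z1): `D` odd forces `V = U` (at `x = U`), then `E` even fails at `x = Y` -/

/-- (Z3, Z1): "`D` odd" forces `V = U`, then "`E` even" fails at `x = Y` -/
theorem core31 (h2 : (2 : F) ≠ 0) (h3 : (3 : F) ≠ 0) (h5 : (5 : F) ≠ 0) (h9 : (9 : F) ≠ 0)
    {I J K Y U V : F} (hs' : 3 * Y + U + V = 0)
    (hY : Y ≠ 0) (hU : U ≠ 0) (hd1 : I ≠ Y) (hd2 : J ≠ Y) (hd3 : K ≠ Y)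
    (hE : ∀ x, 2 * nU I J K (-x) - mZ Y U V (-x) = 2 * nU I J K x - mZ Y U V x)
    (hD : ∀ x, -(ind (U = -x) - ind (V = -x)) = ind (U = x) - ind (V = x)) : False := by
  have f1 : U ≠ -U := fun h => mul_ne h2 hU (by linear_combination h)
  have f2 : V ≠ -U := fun h => mul_ne h3 hY (by linear_combination hs' - h)
  have dU := hD U
  simp only [ind_True, ind_neg f1, ind_neg f2] at dU
  by_cases hUV : U = V
  swap
  · have hVU : V ≠ U := fun h => hUV h.symm
    rw [ind_neg hVU] at dU; omega
  subst hUV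
  have f3 : Y ≠ -Y := fun h => mul_ne h2 hY (by linear_combination h)
  have f4 : U ≠ Y := fun h => mul_ne h5 hY (by linear_combination hs' - 2 * h)
  have f5 : U ≠ 3 * Y := fun h => mul_ne h9 hY (by linear_combination hs' - 2 * h)
  have f6 : U ≠ -Y := fun h => hY (by linear_combination hs' - 2 * h)
  have f7 : U ≠ -(3 * Y) := fun h => mul_ne h3 hY (by linear_combination -hs' + 2 * h)
  have e := hE Y
  simp only [nU, mZ, mul_neg, ind_True, ind_neg hd1, ind_neg hd2, ind_neg hd3, ind_neg f3, ind_neg f4,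
    ind_neg f5, ind_neg f6, ind_neg f7] at e
  have := ind_bd (I = -Y); have := ind_bd (J = -Y); have := ind_bd (K = -Y)
  omega

/-! ## 5. (Z1, Z1) -/

/-- (Z1, Z1): "`E` even" and "`D` odd" are jointly impossible (dichotomy `T′ ≡ −T` or `U = V`) -/
theorem coreZZ (h2 : (2 : F) ≠ 0) (h3 : (3 : F) ≠ 0) (h4 : (4 : F) ≠ 0) (h5 : (5 : F) ≠ 0) (h7 : (7 : F) ≠ 0)
    (h9 : (9 : F) ≠ 0) (h15 : (15 : F) ≠ 0)
    {Y U V Y' U' V' : F} (hs : 3 * Y + U + V = 0) (hs' : 3 * Y' + U' + V' = 0)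
    (hY : Y ≠ 0) (hU : U ≠ 0) (hV : V ≠ 0) (hY' : Y' ≠ 0) (hU' : U' ≠ 0) (hV' : V' ≠ 0)
    (hdU : U' ≠ U) (hdV : V' ≠ V)
    (hE : ∀ x, mZ Y U V (-x) - mZ Y' U' V' (-x) = mZ Y U V x - mZ Y' U' V' x)
    (hD : ∀ x, dZ U V U' V' (-x) = -dZ U V U' V' x) : False := by
  -- Step 1: `D` odd at `x = U`
  have f1 : U ≠ -U := fun h => mul_ne h2 hU (by linear_combination h)
  have f2 : V ≠ -U := fun h => mul_ne h3 hY (by linear_combination hs - h)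
  have dU := hD U
  simp only [dZ, ind_True, ind_neg f1, ind_neg f2, ind_neg hdU] at dU
  by_cases hA : U' = -U
  · ----------------------------------------------------------------- case (α): T′ ≡ −T
    subst hA
    have f3 : U ≠ -V := fun h => mul_ne h3 hY (by linear_combination hs - h)
    have f4 : V ≠ -V := fun h => mul_ne h2 hV (by linear_combination h)
    have dV := hD V
    simp only [dZ, neg_neg, neg_eq_iff_eq_neg, ind_True, ind_neg f3, ind_neg f4, ind_neg hdV] at dV
    by_cases hB : V' = -V
    swap
    · rw [ind_neg hB] at dV; omega
    subst hB
    have hC : Y' = -Y := by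
      have h : (3 : F) * (Y' + Y) = 0 := by linear_combination hs' + hs
      rcases mul_eq_zero.mp h with h | h
      · exact absurd h h3
      · linear_combination h
    subst hC
    -- `E` even at `x = Y`
    have f5 : Y ≠ -Y := fun h => mul_ne h2 hY (by linear_combination h)
    have f6 : U ≠ -(3 * Y) := fun h => hV (by linear_combination hs - h)
    have f7 : V ≠ -(3 * Y) := fun h => hU (by linear_combination hs - h)
    have e := hE Y
    simp only [mZ, mul_neg, neg_neg, neg_eq_iff_eq_neg, ind_True, ind_neg f5, ind_neg f6, ind_neg f7] at e
    have g1 : ¬ (U = -Y ∧ V = -Y) := fun hh => hY (by linear_combination hs - hh.1 - hh.2)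
    by_cases hU3 : U = 3 * Y
    · have hV6 : V = -(6 * Y) := by linear_combination hs - hU3
      have f8 : U ≠ -Y := fun h => mul_ne h4 hY (by linear_combination h - hU3)
      have f9 : V ≠ -Y := fun h => mul_ne h5 hY (by linear_combination hV6 - h)
      have f10 : U ≠ Y := fun h => mul_ne h2 hY (by linear_combination h - hU3)
      have f11 : V ≠ 3 * Y := fun h => mul_ne h9 hY (by linear_combination hV6 - h)
      have f12 : V ≠ Y := fun h => mul_ne h7 hY (by linear_combination hV6 - h)
      rw [ind_pos hU3, ind_neg f8, ind_neg f9, ind_neg f10, ind_neg f11, ind_neg f12] at e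
      omega
    · by_cases hV3 : V = 3 * Y
      · have hU6 : U = -(6 * Y) := by linear_combination hs - hV3
        have f8 : V ≠ -Y := fun h => mul_ne h4 hY (by linear_combination h - hV3)
        have f9 : U ≠ -Y := fun h => mul_ne h5 hY (by linear_combination hU6 - h)
        have f10 : V ≠ Y := fun h => mul_ne h2 hY (by linear_combination h - hV3)
        have f12 : U ≠ Y := fun h => mul_ne h7 hY (by linear_combination hU6 - h)
        rw [ind_pos hV3, ind_neg hU3, ind_neg f8, ind_neg f9, ind_neg f10, ind_neg f12] at e
        omega
      · rw [ind_neg hU3, ind_neg hV3] at e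
        by_cases hUm : U = -Y
        · by_cases hVm : V = -Y
          · exact g1 ⟨hUm, hVm⟩
          · rw [ind_pos hUm, ind_neg hVm] at e
            have := ind_bd (U = Y); have := ind_bd (V = Y)
            omega
        · rw [ind_neg hUm] at e
          have := ind_bd (U = Y); have := ind_bd (V = Y); have := ind_bd (V = -Y)
          omega
  · ----------------------------------------------------------------- case (β): U = V and U′ = V′
    rw [ind_neg hA] at dU
    by_cases hB : U = V
    swap
    · have hVU : V ≠ U := fun h => hB h.symm
      rw [ind_neg hVU] at dU
      have := ind_bd (V' = U); have := ind_bd (V' = -U)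
      omega
    subst hB
    have f3 : U' ≠ -U' := fun h => mul_ne h2 hU' (by linear_combination h)
    have f4 : V' ≠ -U' := fun h => mul_ne h3 hY' (by linear_combination hs' - h)
    have dU' := hD U'
    simp only [dZ, sub_self, ind_True, ind_neg f3, ind_neg f4] at dU'
    by_cases hC : U' = V'
    swap
    · have hVU' : V' ≠ U' := fun h => hC h.symm
      rw [ind_neg hVU'] at dU'; omega
    subst hC
    -- now `hs : 3Y + U + U = 0`, `hs' : 3Y' + U' + U' = 0`, `hdU : U' ≠ U`, `hA : U' ≠ -U`
    have fYY : Y' ≠ Y := by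
      intro h
      have h2c : (2 : F) * (U' - U) = 0 := by linear_combination hs' - hs - 3 * h
      rcases mul_eq_zero.mp h2c with h' | h'
      · exact h2 h'
      · exact hdU (by linear_combination h')
    -- `E` even at `x = Y`
    have f5 : Y ≠ -Y := fun h => mul_ne h2 hY (by linear_combination h)
    have f6 : U ≠ -Y := fun h => hY (by linear_combination hs - 2 * h)
    have f7 : U ≠ -(3 * Y) := fun h => mul_ne h3 hY (by linear_combination -hs + 2 * h)
    have f8 : U ≠ Y := fun h => mul_ne h5 hY (by linear_combination hs - 2 * h)
    have f9 : U ≠ 3 * Y := fun h => mul_ne h9 hY (by linear_combination hs - 2 * h)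
    have e := hE Y
    simp only [mZ, mul_neg, ind_True, ind_neg f5, ind_neg f6, ind_neg f7, ind_neg f8, ind_neg f9,
      ind_neg fYY] at e
    -- `E` even at `x = Y'`
    have f5' : Y' ≠ -Y' := fun h => mul_ne h2 hY' (by linear_combination h)
    have f6' : U' ≠ -Y' := fun h => hY' (by linear_combination hs' - 2 * h)
    have f7' : U' ≠ -(3 * Y') := fun h => mul_ne h3 hY' (by linear_combination -hs' + 2 * h)
    have f8' : U' ≠ Y' := fun h => mul_ne h5 hY' (by linear_combination hs' - 2 * h)
    have f9' : U' ≠ 3 * Y' := fun h => mul_ne h9 hY' (by linear_combination hs' - 2 * h)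
    have e' := hE Y'
    simp only [mZ, mul_neg, ind_True, ind_neg f5', ind_neg f6', ind_neg f7', ind_neg f8', ind_neg f9',
      ind_neg (Ne.symm fYY)] at e'
    by_cases hB1 : U' = -(3 * Y)
    · -- then `Y' = 2Y`
      have hY2 : Y' = 2 * Y := by
        have h3c : (3 : F) * (Y' - 2 * Y) = 0 := by linear_combination hs' - 2 * hB1
        rcases mul_eq_zero.mp h3c with h | h
        · exact absurd h h3
        · linear_combination h
      have j1 : Y ≠ -Y' := fun h => mul_ne h3 hY (by linear_combination h - hY2)
      have j2 : U ≠ -Y' := fun h => hY (by linear_combination -hs + 2 * h - 2 * hY2)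
      have j3 : U ≠ -(3 * Y') := fun h => mul_ne h9 hY (by linear_combination -hs + 2 * h - 6 * hY2)
      have j4 : U ≠ Y' := fun h => mul_ne h7 hY (by linear_combination hs - 2 * h - 2 * hY2)
      have j5 : U ≠ 3 * Y' := fun h => mul_ne h15 hY (by linear_combination hs - 2 * h - 6 * hY2)
      rw [ind_neg j1, ind_neg j2, ind_neg j3, ind_neg j4, ind_neg j5] at e'
      omega
    · by_cases hB2 : U' = Y
      · have hY'2 : 3 * Y' = -(2 * Y) := by linear_combination hs' - 2 * hB2
        have j1 : Y ≠ -Y' := fun h => hY (by linear_combination 3 * h - hY'2)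
        have j3 : U ≠ -(3 * Y') := fun h => mul_ne h7 hY (by linear_combination hs - 2 * h + 2 * hY'2)
        have j4 : U ≠ Y' := fun h => mul_ne h5 hY (by linear_combination 3 * hs - 6 * h - 2 * hY'2)
        have j5 : U ≠ 3 * Y' := fun h => hY (by linear_combination -1 * hs + 2 * h + 2 * hY'2)
        rw [ind_neg j1, ind_neg j3, ind_neg j4, ind_neg j5] at e'
        have := ind_bd (U = -Y')
        omega
      · rw [ind_neg hB1, ind_neg hB2] at e
        have := ind_bd (Y' = -Y); have := ind_bd (U' = -Y); have := ind_bd (U' = 3 * Y)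
        omega


end Core

end HodgeFermat.KRFree.Decoding
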